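import Summits.QuantumFields.BalabanUV.Beta.KernelWardRelative
import Summits.QuantumFields.BalabanUV.Beta.ChartConjugationReflection

/-!
# `BalabanUV.Beta.D1BFx.DressedBubbleBridge` — road «BF-x» for binder row D1, leaf A4 (part 1, generic): EXCHANGE OF THE
# `ℋ`-SUPERPOSITION SERIES WITH THE TRACE, THE TADPOLE AND THE BUBBLE — `tr (Σ'_u w_u K_u) = Σ'_u w_u tr K_u`,
# `tadpole A (Σ'_u w_u W_u) = Σ'_u w_u tadpole A W_u`, `bubble A (Σ'_u w_u S_u) (Σ'_{u'} w'_{u'} S'_{u'}) =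
# Σ'_{(u,u')} w_u w'_{u'} bubble A S_u S'_{u'}` for spread `A`, exponentially decaying weights and self-localised families

HONEST FRAMING (cell contract, verbatim): «discharging `BetaPertH` makes Bałaban's UV stability UNCONDITIONAL — a real
constructive-QFT result; it is NOT the continuum limit and NOT the Clay problem.»  [folklore] analysis of absolutely convergent
lattice sums in the EXISTENTIAL currency of `TameKernelCalculus` (`Spr`/`Loc`), composed BY NAME from the tree:
`ChartConjugationReflection.comp_wsum` / `wsum_comp` (exchange with `comp`), `KernelWard.tsum_comm_of_prodBound` (Fubini under a
product majorant), `ExpKernelCalculus.biLoc_comp_decays` / `biLoc_comp_biLoc` (localisation bookkeeping), `OneStepResolventKernel.biLoc_wsum`,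
`TameKernelCalculus.bubble_add_right`, `KernelWardRelative.loc_finset_sum` / `bubble_finset_sum_left` / `tadpole_finset_sum`,
Mathlib `Summable.tsum_prod'`.  Nothing of the manuscripts under audit is asserted or cited; no `Prop` fact is minted; nothing
of D1 / BetaPertH is discharged.  Value = kernel bookkeeping for road BF-x (skeleton `HOME/beta/skeletons/D1-b2b-balaban-beta-d1-p2.md`
v1.4 nodes R4/R5/A4; claim table `LEAVES-BFx.md` row A4), NOT summit progress; NOT continuum, NOT Clay.
HONEST DEPENDENCY (verbatim): continuum YM on T⁴ ⇐ BetaPertH ∧ nine spine estimates (0/9 proved); BetaPertH ⇐ (D1) ∧ (D4) ∧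
CAP+tail; G-an2-4 gates asym, D1 and NE2/3/4.

WHY.  The road's typed one-shot kernel is `ReducedKernel.TOfRed n a S W = hessKer (Ga n a) (vertexRed n S) W` (T8) whose first-order
vertex `vertexRed n S μ y = Σ_{κ′} Σ'_u ℋ_{(κ′,u),(μ,y)} · S κ′ u` is an `ℋ`-SUPERPOSITION of fine stencils; leaf K-R5
(`MomentTransferPeriodicEntry`) computes the decimated second moment of any `ℋ`-SANDWICH `Σ ℋ · P · ℋ` of a block-periodic fine two-point
kernel `P`.  The bridge between the two is the statement that the bubble (and the tadpole) of superposed vertices IS the superposition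
of the bubbles (tadpoles) — an exchange of absolutely convergent series with `comp` and `tr`.  THIS FILE proves those exchanges once,
generically (any dimension `D`, any finite fibre `F`); part 2 (`DressedBubbleTable`) instantiates them for `TOfRed`.

CONTENT (all [folklore], `[Fintype F]`, `[Nonempty F]` where a constant's sign is read off a bound):
* §1 `spr_of_loc` (a localised kernel is spread), `summable_abs_of_expWeight`, `loc_wsum`, `bubble_zero_right`, `bubble_finset_sum_right`.
* §2 **`tr_wsum`** — the trace of a weighted superposition whose diagonal is dominated by ONE fixed exponential profile.
* §3 **`tadpole_wsum`**, **`bubble_wsum_left`**, **`bubble_wsum_right`** (spread `A`, weights `|w u| ≤ Cw e^{−δ|u−p|}`, family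
  `S u` bi-localised at `(u,u)`, the other slot localised).
* §4 **`bubble_wsum_wsum`** — both slots superposed: ONE absolutely convergent sum over `ℤ^D × ℤ^D`.
-/

namespace Summit.QuantumFields.BalabanUV.Beta.D1BFx.DressedBubbleBridge

open Finset
open scoped BigOperators
open Literature.MathematicalPhysics.QuantumFieldTheory.Balaban1983to89
open Literature.MathematicalPhysics.QuantumFieldTheory.Balaban1983to89.Beta
open B12Sec2to5 (l1 l1_nonneg)
open ExpKernelCalculus (MKer Site Decays BiLoc comp tr bubble tadpole Zl Zl_nonneg summable_exp_shift summable_exp_shift'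
  biLoc_comp_decays biLoc_comp_biLoc l1_sub_triangle l1_sub_symm abs_bubble_le)
open KernelWard (Bdd bdd_of_biLoc ProdBound tsum_comm_of_prodBound)
open OneStepResolventKernel (wsum biLoc_wsum)
open StepDriftWitness (comp_zero_right)
open Summit.QuantumFields.BalabanUV.Beta.TameKernelCalculus
open Summit.QuantumFields.BalabanUV.Beta.ChartConjugationReflection (comp_wsum wsum_comp)
open Summit.QuantumFields.BalabanUV.Beta.KernelWardRelative (loc_zero tr_zero bubble_zero_left loc_finset_sum)

noncomputable section

variable {D : ℕ} {F : Type*} [Fintype F]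

/-! ## §1 Class bookkeeping -/

omit [Fintype F] in
/-- [folklore] A LOCALISED kernel is SPREAD: `C e^{−δ(|x−p|+|y−q|)} ≤ (|C| e^{δ|p−q|}) · e^{−δ|x−y|}` (triangle inequality). -/
theorem spr_of_loc {K : MKer D F} (h : Loc K) : Spr K := by
  obtain ⟨p, q, C, δ, hδ, hK⟩ := h
  refine ⟨|C| * Real.exp (δ * l1 (p - q)), δ, hδ, fun x y a b => (hK x y a b).trans ?_⟩
  have htri : l1 (x - y) ≤ l1 (x - p) + l1 (p - q) + l1 (y - q) := by
    have h1 := l1_sub_triangle x p y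
    have h2 := l1_sub_triangle p q y
    rw [l1_sub_symm q y] at h2
    linarith
  calc C * Real.exp (-δ * (l1 (x - p) + l1 (y - q))) ≤ |C| * Real.exp (-δ * (l1 (x - p) + l1 (y - q))) :=
        mul_le_mul_of_nonneg_right (le_abs_self C) (Real.exp_pos _).le
    _ ≤ |C| * (Real.exp (δ * l1 (p - q)) * Real.exp (-δ * l1 (x - y))) := by
        refine mul_le_mul_of_nonneg_left ?_ (abs_nonneg C)
        rw [← Real.exp_add]
        exact Real.exp_le_exp.2 (by nlinarith [hδ.le])
    _ = |C| * Real.exp (δ * l1 (p - q)) * Real.exp (-δ * l1 (x - y)) := by ring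

omit [Fintype F] in
/-- [folklore] Exponentially decaying weights are absolutely summable. -/
theorem summable_abs_of_expWeight {w : Site D → ℝ} {Cw δ : ℝ} {p : Site D}
    (hw : ∀ u, |w u| ≤ Cw * Real.exp (-δ * l1 (u - p))) (hδ : 0 < δ) : Summable fun u => |w u| :=
  Summable.of_nonneg_of_le (fun _ => abs_nonneg _) hw ((summable_exp_shift' hδ p).mul_left Cw)

omit [Fintype F] in
/-- [folklore] A weighted superposition of a self-localised family with weights decaying from `p` is localised (at `p`;
`OneStepResolventKernel.biLoc_wsum`). -/
theorem loc_wsum {w : Site D → ℝ} {S : Site D → MKer D F} {Cw Cs δ : ℝ} {p : Site D}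
    (hw : ∀ u, |w u| ≤ Cw * Real.exp (-δ * l1 (u - p))) (hCw : 0 ≤ Cw) (hS : ∀ u, BiLoc (S u) u u Cs δ) (hδ : 0 < δ) :
    Loc (wsum w S) :=
  ⟨p, p, _, δ / 2, half_pos hδ, biLoc_wsum hw hS hδ hCw⟩

/-- [folklore] A bubble with the zero vertex in the second slot vanishes. -/
theorem bubble_zero_right (A V : MKer D F) : bubble A V 0 = 0 := by
  simp only [ExpKernelCalculus.bubble, comp_zero_right, tr_zero]

/-- [folklore] The bubble of a finite sum of localised vertices in the SECOND slot is the sum of the bubbles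
(`TameKernelCalculus.bubble_add_right` by induction; the first-slot twin is `KernelWardRelative.bubble_finset_sum_left`). -/
theorem bubble_finset_sum_right {ι : Type*} (s : Finset ι) {A Y : MKer D F} {Z : ι → MKer D F} (hA : Spr A) (hY : Loc Y)
    (h : ∀ i, Loc (Z i)) : bubble A Y (∑ i ∈ s, Z i) = ∑ i ∈ s, bubble A Y (Z i) := by
  classical
  refine Finset.induction_on s ?_ ?_
  · simp only [Finset.sum_empty, bubble_zero_right]
  · intro a s ha ih
    rw [Finset.sum_insert ha, Finset.sum_insert ha, bubble_add_right hA hY (h a) (loc_finset_sum s h), ih]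

/-! ## §2 The trace of a weighted superposition -/

/-- [folklore] **`tr (Σ'_u w_u K_u) = Σ'_u w_u · tr K_u`** for absolutely summable weights and a family whose DIAGONAL is dominated by
one fixed exponential profile `|K_u x x a a| ≤ C e^{−δ|x−q|}` (every `BiLoc (K u) (p u) q` or `BiLoc (K u) q (p u)` family is such:
drop one factor) — Fubini under the product majorant `e^{−δ|x−q|} ⊗ |w u|` (`KernelWard.tsum_comm_of_prodBound`). -/
theorem tr_wsum {w : Site D → ℝ} {K : Site D → MKer D F} (hw : Summable fun u => |w u|) {C δ : ℝ} {q : Site D}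
    (hδ : 0 < δ) (hK : ∀ u x a, |K u x x a a| ≤ C * Real.exp (-δ * l1 (x - q))) :
    tr (wsum w K) = ∑' u, w u * tr (K u) := by
  show (∑' x, ∑ a, ∑' u, w u * K u x x a a) = ∑' u, w u * ∑' x, ∑ a, K u x x a a
  have hs : ∀ x a, Summable fun u => w u * K u x x a a := fun x a => by
    refine Summable.of_norm_bounded (hw.mul_right (C * Real.exp (-δ * l1 (x - q)))) (fun u => ?_)
    rw [Real.norm_eq_abs, abs_mul]
    exact mul_le_mul_of_nonneg_left (hK u x a) (abs_nonneg _)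
  have step1 : (fun x => ∑ a, ∑' u, w u * K u x x a a) = fun x => ∑' u, ∑ a, w u * K u x x a a :=
    funext fun x => (Summable.tsum_finsetSum (fun a _ => hs x a)).symm
  rw [step1]
  have hPB : ProdBound (fun x u => ∑ a, w u * K u x x a a) := by
    refine ⟨fun x => ((Fintype.card F : ℝ) * |C|) * Real.exp (-δ * l1 (x - q)), fun u => |w u|,
      (summable_exp_shift' hδ q).mul_left _, hw, fun x => by positivity, fun u => abs_nonneg _, fun x u => ?_⟩
    calc |∑ a, w u * K u x x a a| ≤ ∑ a, |w u * K u x x a a| := Finset.abs_sum_le_sum_abs _ _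
      _ ≤ ∑ _a : F, |C| * Real.exp (-δ * l1 (x - q)) * |w u| := Finset.sum_le_sum fun a _ => by
          rw [abs_mul, mul_comm]
          exact mul_le_mul_of_nonneg_right ((hK u x a).trans
            (mul_le_mul_of_nonneg_right (le_abs_self C) (Real.exp_pos _).le)) (abs_nonneg _)
      _ = ((Fintype.card F : ℝ) * |C|) * Real.exp (-δ * l1 (x - q)) * |w u| := by
          rw [Finset.sum_const, Finset.card_univ, nsmul_eq_mul]; ring
  rw [tsum_comm_of_prodBound hPB]
  refine tsum_congr fun u => ?_
  rw [← tsum_mul_left]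
  refine tsum_congr fun x => ?_
  rw [Finset.mul_sum]

omit [Fintype F] in
/-- [folklore] Raising the constant of a `BiLoc` bound. -/
theorem biLoc_const_mono {K : MKer D F} {p q : Site D} {C C' δ : ℝ} (h : BiLoc K p q C δ) (hCC' : C ≤ C') :
    BiLoc K p q C' δ := fun x y a b =>
  (h x y a b).trans (mul_le_mul_of_nonneg_right hCC' (Real.exp_pos _).le)

omit [Fintype F] in
/-- [folklore] DIAGONAL PROFILE, second centre: `BiLoc K p q C δ`, `0 ≤ C`, `0 ≤ δ` ⟹ `|K x x a a| ≤ C e^{−δ|x−q|}`. -/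
theorem diag_le_of_biLoc_snd {K : MKer D F} {p q : Site D} {C δ : ℝ} (h : BiLoc K p q C δ) (hC : 0 ≤ C) (hδ : 0 ≤ δ)
    (x : Site D) (a : F) : |K x x a a| ≤ C * Real.exp (-δ * l1 (x - q)) := by
  refine (h x x a a).trans (mul_le_mul_of_nonneg_left (Real.exp_le_exp.2 ?_) hC)
  nlinarith [l1_nonneg (x - p)]

omit [Fintype F] in
/-- [folklore] DIAGONAL PROFILE, first centre: `BiLoc K p q C δ` ⟹ `|K x x a a| ≤ C e^{−δ|x−p|}`. -/
theorem diag_le_of_biLoc_fst {K : MKer D F} {p q : Site D} {C δ : ℝ} (h : BiLoc K p q C δ) (hC : 0 ≤ C) (hδ : 0 ≤ δ)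
    (x : Site D) (a : F) : |K x x a a| ≤ C * Real.exp (-δ * l1 (x - p)) := by
  refine (h x x a a).trans (mul_le_mul_of_nonneg_left (Real.exp_le_exp.2 ?_) hC)
  nlinarith [l1_nonneg (x - q)]

omit [Fintype F] in
/-- [folklore] Lowering the rate of an exponential weight bound. -/
theorem expWeight_of_le {w : Site D → ℝ} {Cw δ δ' : ℝ} {p : Site D} (hw : ∀ u, |w u| ≤ Cw * Real.exp (-δ * l1 (u - p)))
    (hCw : 0 ≤ Cw) (h : δ' ≤ δ) (u : Site D) : |w u| ≤ Cw * Real.exp (-δ' * l1 (u - p)) :=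
  (hw u).trans (mul_le_mul_of_nonneg_left (Real.exp_le_exp.2 (by nlinarith [l1_nonneg (u - p)])) hCw)

/-! ## §3 Tadpole and bubble of a weighted superposition -/

section Exchange

variable [Nonempty F]

omit [Nonempty F] in
/-- [folklore] **`tadpole A (Σ'_u w_u W_u) = Σ'_u w_u · tadpole A W_u`** — spread `A`, absolutely summable weights, a uniformly bounded
family whose compositions `A ∘ W_u` have a common diagonal profile (`ChartConjugationReflection.comp_wsum` + `tr_wsum`). -/
theorem tadpole_wsum_of_profile {A : MKer D F} {w : Site D → ℝ} {W : Site D → MKer D F} (hA : Spr A)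
    (hw : Summable fun u => |w u|) {B : ℝ} (hB0 : 0 ≤ B) (hB : ∀ u x z a b, |W u x z a b| ≤ B)
    {C δ : ℝ} {q : Site D} (hδ : 0 < δ) (hAW : ∀ u x a, |comp A (W u) x x a a| ≤ C * Real.exp (-δ * l1 (x - q))) :
    tadpole A (wsum w W) = ∑' u, w u * tadpole A (W u) := by
  unfold ExpKernelCalculus.tadpole
  rw [comp_wsum hA hw hB0 hB, tr_wsum hw hδ hAW]

/-- [folklore] **TADPOLE EXCHANGE, family localised at `(u, q)`** (index = first centre, second centre fixed). -/
theorem tadpole_wsum_fst {A : MKer D F} {w : Site D → ℝ} {W : Site D → MKer D F} (hA : Spr A)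
    (hw : Summable fun u => |w u|) {CW δ : ℝ} {q : Site D} (hW : ∀ u, BiLoc (W u) u q CW δ) (hδ : 0 < δ) :
    tadpole A (wsum w W) = ∑' u, w u * tadpole A (W u) := by
  obtain ⟨a₀⟩ := (inferInstance : Nonempty F)
  obtain ⟨CA, δA, hδA, hAd⟩ := hA
  have hCW : 0 ≤ CW := (hW 0).nonneg a₀
  set m : ℝ := min δA δ with hm
  have hm0 : 0 < m := lt_min hδA hδ
  have hAd' : Decays A (|CA|) m := decays_of_le hAd (min_le_left _ _)
  have hW' : ∀ u, BiLoc (W u) u q (|CW|) m := fun u => biLoc_of_le (hW u) (min_le_right _ _)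
  have hAW : ∀ u, BiLoc (comp A (W u)) u q ((Fintype.card F : ℝ) * (|CA| * |CW|) * Zl D (m - m / 2)) (m / 2) :=
    fun u => biLoc_comp_decays hAd' (hW' u) (by positivity) (by linarith)
  have hC1 : 0 ≤ (Fintype.card F : ℝ) * (|CA| * |CW|) * Zl D (m - m / 2) :=
    mul_nonneg (by positivity) (Zl_nonneg (by linarith))
  exact tadpole_wsum_of_profile ⟨CA, δA, hδA, hAd⟩ hw hCW (fun u x z a b => bdd_of_biLoc (hW u) hδ.le x z a b)
    (half_pos hm0) (fun u x a => diag_le_of_biLoc_snd (hAW u) hC1 (half_pos hm0).le x a)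

/-- [folklore] **TADPOLE EXCHANGE, family localised at `(q, u)`** (first centre fixed, index = second centre). -/
theorem tadpole_wsum_snd {A : MKer D F} {w : Site D → ℝ} {W : Site D → MKer D F} (hA : Spr A)
    (hw : Summable fun u => |w u|) {CW δ : ℝ} {q : Site D} (hW : ∀ u, BiLoc (W u) q u CW δ) (hδ : 0 < δ) :
    tadpole A (wsum w W) = ∑' u, w u * tadpole A (W u) := by
  obtain ⟨a₀⟩ := (inferInstance : Nonempty F)
  obtain ⟨CA, δA, hδA, hAd⟩ := hA
  have hCW : 0 ≤ CW := (hW 0).nonneg a₀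
  set m : ℝ := min δA δ with hm
  have hm0 : 0 < m := lt_min hδA hδ
  have hAd' : Decays A (|CA|) m := decays_of_le hAd (min_le_left _ _)
  have hW' : ∀ u, BiLoc (W u) q u (|CW|) m := fun u => biLoc_of_le (hW u) (min_le_right _ _)
  have hAW : ∀ u, BiLoc (comp A (W u)) q u ((Fintype.card F : ℝ) * (|CA| * |CW|) * Zl D (m - m / 2)) (m / 2) :=
    fun u => biLoc_comp_decays hAd' (hW' u) (by positivity) (by linarith)
  have hC1 : 0 ≤ (Fintype.card F : ℝ) * (|CA| * |CW|) * Zl D (m - m / 2) :=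
    mul_nonneg (by positivity) (Zl_nonneg (by linarith))
  exact tadpole_wsum_of_profile ⟨CA, δA, hδA, hAd⟩ hw hCW (fun u x z a b => bdd_of_biLoc (hW u) hδ.le x z a b)
    (half_pos hm0) (fun u x a => diag_le_of_biLoc_fst (hAW u) hC1 (half_pos hm0).le x a)

/-- [folklore] **`bubble A (Σ'_u w_u S_u) Z = Σ'_u w_u · bubble A S_u Z`** — spread `A`, localised `Z`, absolutely summable weights,
a family `S u` bi-localised at `(u, u)` with uniform constant and rate (`comp_wsum`, `wsum_comp`, `tr_wsum`). -/
theorem bubble_wsum_left {A Z : MKer D F} {w : Site D → ℝ} {S : Site D → MKer D F} (hA : Spr A) (hZ : Loc Z)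
    (hw : Summable fun u => |w u|) {Cs δ : ℝ} (hS : ∀ u, BiLoc (S u) u u Cs δ) (hδ : 0 < δ) :
    bubble A (wsum w S) Z = ∑' u, w u * bubble A (S u) Z := by
  obtain ⟨a₀⟩ := (inferInstance : Nonempty F)
  obtain ⟨CA, δA, hδA, hAd⟩ := hA
  obtain ⟨pZ, qZ, CZ, δZ, hδZ, hZb⟩ := hZ
  have hCs : 0 ≤ Cs := (hS 0).nonneg a₀
  set m : ℝ := min δA (min δ δZ) with hm
  have hm0 : 0 < m := lt_min hδA (lt_min hδ hδZ)
  have hm2 : 0 < m / 2 := half_pos hm0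
  have hAd' : Decays A (|CA|) m := decays_of_le hAd (min_le_left _ _)
  have hS' : ∀ u, BiLoc (S u) u u (|Cs|) m := fun u =>
    biLoc_of_le (hS u) ((min_le_right _ _).trans (min_le_left _ _))
  have hZ' : BiLoc Z pZ qZ (|CZ|) m := biLoc_of_le hZb ((min_le_right _ _).trans (min_le_right _ _))
  -- step 1: `A ∘ (Σ w S) = Σ w (A ∘ S)`
  have h1 : comp A (wsum w S) = wsum w (fun u => comp A (S u)) :=
    comp_wsum ⟨CA, δA, hδA, hAd⟩ hw hCs (fun u x z a b => bdd_of_biLoc (hS u) hδ.le x z a b)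
  -- localisation of the letters
  set C1 : ℝ := (Fintype.card F : ℝ) * (|CA| * |Cs|) * Zl D (m - m / 2) with hC1
  set C2 : ℝ := (Fintype.card F : ℝ) * (|CA| * |CZ|) * Zl D (m - m / 2) with hC2
  have hC10 : 0 ≤ C1 := mul_nonneg (by positivity) (Zl_nonneg (by linarith))
  have hC20 : 0 ≤ C2 := mul_nonneg (by positivity) (Zl_nonneg (by linarith))
  have hAS : ∀ u, BiLoc (comp A (S u)) u u C1 (m / 2) := fun u => biLoc_comp_decays hAd' (hS' u) hm2.le (by linarith)
  have hAZ : BiLoc (comp A Z) pZ qZ C2 (m / 2) := biLoc_comp_decays hAd' hZ' hm2.le (by linarith)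
  -- step 2: `(Σ w (A∘S)) ∘ (A ∘ Z) = Σ w ((A∘S_u) ∘ (A∘Z))`
  have h2 : comp (wsum w (fun u => comp A (S u))) (comp A Z) = wsum w (fun u => comp (comp A (S u)) (comp A Z)) :=
    wsum_comp (spr_of_loc ⟨pZ, qZ, C2, m / 2, hm2, hAZ⟩) hw hC10 (fun u x z a b => bdd_of_biLoc (hAS u) hm2.le x z a b)
  -- step 3: the diagonal profile of `(A∘S_u)∘(A∘Z)`, uniformly in `u`
  set C3 : ℝ := (Fintype.card F : ℝ) * (C1 * C2) * Zl D (m / 2 / 2) with hC3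
  have hC30 : 0 ≤ C3 := mul_nonneg (mul_nonneg (Nat.cast_nonneg _) (mul_nonneg hC10 hC20)) (Zl_nonneg (by linarith))
  have hK : ∀ u, BiLoc (comp (comp A (S u)) (comp A Z)) u qZ C3 (m / 2) := fun u =>
    biLoc_const_mono (biLoc_comp_biLoc (hAS u) hAZ hm2)
      (mul_le_of_le_one_right hC30 (Real.exp_le_one_iff.2 (by nlinarith [l1_nonneg (u - pZ)])))
  have h3 := tr_wsum (K := fun u => comp (comp A (S u)) (comp A Z)) hw hm2
    (fun u x a => diag_le_of_biLoc_snd (hK u) hC30 hm2.le x a)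
  unfold ExpKernelCalculus.bubble
  rw [h1, h2, h3]

/-- [folklore] **`bubble A Y (Σ'_u w_u S_u) = Σ'_u w_u · bubble A Y S_u`** (second slot; `comp_wsum` twice + `tr_wsum`). -/
theorem bubble_wsum_right {A Y : MKer D F} {w : Site D → ℝ} {S : Site D → MKer D F} (hA : Spr A) (hY : Loc Y)
    (hw : Summable fun u => |w u|) {Cs δ : ℝ} (hS : ∀ u, BiLoc (S u) u u Cs δ) (hδ : 0 < δ) :
    bubble A Y (wsum w S) = ∑' u, w u * bubble A Y (S u) := by
  obtain ⟨a₀⟩ := (inferInstance : Nonempty F)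
  obtain ⟨CA, δA, hδA, hAd⟩ := hA
  obtain ⟨pY, qY, CY, δY, hδY, hYb⟩ := hY
  have hCs : 0 ≤ Cs := (hS 0).nonneg a₀
  set m : ℝ := min δA (min δ δY) with hm
  have hm0 : 0 < m := lt_min hδA (lt_min hδ hδY)
  have hm2 : 0 < m / 2 := half_pos hm0
  have hAd' : Decays A (|CA|) m := decays_of_le hAd (min_le_left _ _)
  have hS' : ∀ u, BiLoc (S u) u u (|Cs|) m := fun u =>
    biLoc_of_le (hS u) ((min_le_right _ _).trans (min_le_left _ _))
  have hY' : BiLoc Y pY qY (|CY|) m := biLoc_of_le hYb ((min_le_right _ _).trans (min_le_right _ _))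
  have h1 : comp A (wsum w S) = wsum w (fun u => comp A (S u)) :=
    comp_wsum ⟨CA, δA, hδA, hAd⟩ hw hCs (fun u x z a b => bdd_of_biLoc (hS u) hδ.le x z a b)
  set C1 : ℝ := (Fintype.card F : ℝ) * (|CA| * |Cs|) * Zl D (m - m / 2) with hC1
  set C2 : ℝ := (Fintype.card F : ℝ) * (|CA| * |CY|) * Zl D (m - m / 2) with hC2
  have hC10 : 0 ≤ C1 := mul_nonneg (by positivity) (Zl_nonneg (by linarith))
  have hC20 : 0 ≤ C2 := mul_nonneg (by positivity) (Zl_nonneg (by linarith))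
  have hAS : ∀ u, BiLoc (comp A (S u)) u u C1 (m / 2) := fun u => biLoc_comp_decays hAd' (hS' u) hm2.le (by linarith)
  have hAY : BiLoc (comp A Y) pY qY C2 (m / 2) := biLoc_comp_decays hAd' hY' hm2.le (by linarith)
  have h2 : comp (comp A Y) (wsum w (fun u => comp A (S u))) = wsum w (fun u => comp (comp A Y) (comp A (S u))) :=
    comp_wsum (spr_of_loc ⟨pY, qY, C2, m / 2, hm2, hAY⟩) hw hC10 (fun u x z a b => bdd_of_biLoc (hAS u) hm2.le x z a b)
  set C3 : ℝ := (Fintype.card F : ℝ) * (C2 * C1) * Zl D (m / 2 / 2) with hC3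
  have hC30 : 0 ≤ C3 := mul_nonneg (mul_nonneg (Nat.cast_nonneg _) (mul_nonneg hC20 hC10)) (Zl_nonneg (by linarith))
  have hK : ∀ u, BiLoc (comp (comp A Y) (comp A (S u))) pY u C3 (m / 2) := fun u =>
    biLoc_const_mono (biLoc_comp_biLoc hAY (hAS u) hm2)
      (mul_le_of_le_one_right hC30 (Real.exp_le_one_iff.2 (by nlinarith [l1_nonneg (qY - u)])))
  have h3 := tr_wsum (K := fun u => comp (comp A Y) (comp A (S u))) hw hm2
    (fun u x a => diag_le_of_biLoc_fst (hK u) hC30 hm2.le x a)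
  unfold ExpKernelCalculus.bubble
  rw [h1, h2, h3]

/-! ## §4 Both slots superposed: one absolutely convergent sum over `ℤ^D × ℤ^D` -/

/-- [folklore] A UNIFORM BOUND for the bubbles of two self-localised families against a spread resolvent (`abs_tr_le` on the
localisation of `(A∘S_u)∘(A∘S'_{u'})`, both exponential gains dropped). -/
theorem exists_bubble_bound {A : MKer D F} {S S' : Site D → MKer D F} (hA : Spr A) {Cs Cs' δ : ℝ}
    (hS : ∀ u, BiLoc (S u) u u Cs δ) (hS' : ∀ u, BiLoc (S' u) u u Cs' δ) (hδ : 0 < δ) :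
    ∃ B : ℝ, 0 ≤ B ∧ ∀ u u', |bubble A (S u) (S' u')| ≤ B := by
  obtain ⟨CA, δA, hδA, hAd⟩ := hA
  set m : ℝ := min δA δ with hm
  have hm0 : 0 < m := lt_min hδA hδ
  have hm2 : 0 < m / 2 := half_pos hm0
  have hAd' : Decays A (|CA|) m := decays_of_le hAd (min_le_left _ _)
  have hS1 : ∀ u, BiLoc (S u) u u (|Cs|) m := fun u => biLoc_of_le (hS u) (min_le_right _ _)
  have hS2 : ∀ u, BiLoc (S' u) u u (|Cs'|) m := fun u => biLoc_of_le (hS' u) (min_le_right _ _)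
  set C1 : ℝ := (Fintype.card F : ℝ) * (|CA| * |Cs|) * Zl D (m - m / 2)
  set C2 : ℝ := (Fintype.card F : ℝ) * (|CA| * |Cs'|) * Zl D (m - m / 2)
  set C3 : ℝ := (Fintype.card F : ℝ) * (C1 * C2) * Zl D (m / 2 / 2)
  have hC10 : 0 ≤ C1 := mul_nonneg (by positivity) (Zl_nonneg (by linarith))
  have hC20 : 0 ≤ C2 := mul_nonneg (by positivity) (Zl_nonneg (by linarith))
  have hC30 : 0 ≤ C3 := mul_nonneg (mul_nonneg (Nat.cast_nonneg _) (mul_nonneg hC10 hC20)) (Zl_nonneg (by linarith))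
  refine ⟨(Fintype.card F : ℝ) * C3 * Zl D (m / 2 / 2), mul_nonneg (mul_nonneg (Nat.cast_nonneg _) hC30) (Zl_nonneg (by linarith)),
    fun u u' => ?_⟩
  have h1 : BiLoc (comp A (S u)) u u C1 (m / 2) := biLoc_comp_decays hAd' (hS1 u) hm2.le (by linarith)
  have h2 : BiLoc (comp A (S' u')) u' u' C2 (m / 2) := biLoc_comp_decays hAd' (hS2 u') hm2.le (by linarith)
  have h3 : BiLoc (comp (comp A (S u)) (comp A (S' u'))) u u' C3 (m / 2) :=
    biLoc_const_mono (biLoc_comp_biLoc h1 h2 hm2)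
      (mul_le_of_le_one_right hC30 (Real.exp_le_one_iff.2 (by nlinarith [l1_nonneg (u - u')])))
  refine (ExpKernelCalculus.abs_tr_le h3 hm2).trans ?_
  exact mul_le_of_le_one_right (mul_nonneg (mul_nonneg (Nat.cast_nonneg _) hC30) (Zl_nonneg (by linarith)))
    (Real.exp_le_one_iff.2 (by nlinarith [l1_nonneg (u - u')]))

/-- [folklore] **BOTH SLOTS SUPERPOSED**: for spread `A`, weights `|w u| ≤ Cw e^{−δw|u−p|}`, `|w' u| ≤ Cw' e^{−δw'|u−p'|}` and two
self-localised families at a common rate,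
`bubble A (Σ'_u w_u S_u) (Σ'_{u'} w'_{u'} S'_{u'}) = Σ'_{(u,u') ∈ ℤ^D × ℤ^D} w_u · w'_{u'} · bubble A S_u S'_{u'}` — ONE absolutely convergent
sum over the product (`bubble_wsum_left` + `bubble_wsum_right` + Mathlib `Summable.tsum_prod'`). -/
theorem bubble_wsum_wsum {A : MKer D F} {w w' : Site D → ℝ} {S S' : Site D → MKer D F} (hA : Spr A)
    {Cw δw : ℝ} {p : Site D} (hw : ∀ u, |w u| ≤ Cw * Real.exp (-δw * l1 (u - p))) (hδw : 0 < δw)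
    {Cw' δw' : ℝ} {p' : Site D} (hw' : ∀ u, |w' u| ≤ Cw' * Real.exp (-δw' * l1 (u - p'))) (hCw' : 0 ≤ Cw') (hδw' : 0 < δw')
    {Cs Cs' δ : ℝ} (hS : ∀ u, BiLoc (S u) u u Cs δ) (hS' : ∀ u, BiLoc (S' u) u u Cs' δ) (hδ : 0 < δ) :
    bubble A (wsum w S) (wsum w' S') = ∑' q : Site D × Site D, w q.1 * w' q.2 * bubble A (S q.1) (S' q.2) := by
  have hwabs : Summable fun u => |w u| := summable_abs_of_expWeight hw hδw
  have hw'abs : Summable fun u => |w' u| := summable_abs_of_expWeight hw' hδw'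
  -- the second superposition is localised (common rate `min δw' δ`)
  have hm : 0 < min δw' δ := lt_min hδw' hδ
  have hZ : Loc (wsum w' S') := loc_wsum (fun u => expWeight_of_le hw' hCw' (min_le_left _ _) u) hCw'
    (fun u => biLoc_of_le (hS' u) (min_le_right _ _)) hm
  rw [bubble_wsum_left hA hZ hwabs hS hδ]
  have hin : ∀ u, bubble A (S u) (wsum w' S') = ∑' u', w' u' * bubble A (S u) (S' u') := fun u =>
    bubble_wsum_right hA ⟨u, u, Cs, δ, hδ, hS u⟩ hw'abs hS' hδ
  simp_rw [hin]
  -- summability on the product from the uniform bubble bound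
  obtain ⟨B, hB0, hB⟩ := exists_bubble_bound hA hS hS' hδ
  have hsum : Summable fun q : Site D × Site D => w q.1 * w' q.2 * bubble A (S q.1) (S' q.2) := by
    refine Summable.of_norm_bounded ((hwabs.mul_of_nonneg hw'abs (fun u => abs_nonneg _) (fun u => abs_nonneg _)).mul_right B)
      (fun q => ?_)
    rw [Real.norm_eq_abs, abs_mul, abs_mul]
    exact mul_le_mul_of_nonneg_left (hB q.1 q.2) (mul_nonneg (abs_nonneg _) (abs_nonneg _))
  rw [Summable.tsum_prod' hsum (fun u => ?_)]
  · refine tsum_congr fun u => ?_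
    rw [← tsum_mul_left]
    exact tsum_congr fun u' => by ring
  · refine Summable.of_norm_bounded ((hw'abs.mul_left (|w u|)).mul_right B) (fun u' => ?_)
    rw [Real.norm_eq_abs, abs_mul, abs_mul]
    exact mul_le_mul_of_nonneg_left (hB u u') (mul_nonneg (abs_nonneg _) (abs_nonneg _))

end Exchange

end

end Summit.QuantumFields.BalabanUV.Beta.D1BFx.DressedBubbleBridge
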